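import Literature.NumberTheory.NumberFields.AmbiguousClassIndexFormula
import HarnessLib

/-!
# Units in an `S₃`-extension, I: the element identities — `E_K = E_k · N_{L/K} E_L`,
# `E_k ∩ N_{L/K}Lˣ = E_k ∩ N_{R/k}Rˣ`, and the `σ`-norm on `τ`-cocycles of `E_L`

Topic `NumberTheory/NumberFields`; namespace `Literature.NumberTheory.NumberFields.DihedralUnits`.
THEOREM-ONLY file (no definition, no named fact, no `sorry`), written by the prover seat
`bsd-line-att-p4` g30 (cell `bsd-f1-sign2`, route `AlignedTransportAtTwo`, `--supports`
stmt-BirchSwinnertonDyer-22298; closes nothing; BSD is proved for no curve here).  First of the files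
kernelising the EXACT `2`-part of the Brauer–Kuroda class number relation of an `S₃`-extension
(`h₂(L) h₂(k)² = h₂(R) h₂(K)²`; C. D. Walter 1979, Caputo–Nuccio 2020 Prop. 3.12, Bartel 2012 Cor. 5.2)
by an ELEMENTARY route: att-p3 g33's counting identity `#A·#(A^{σ,τ})² = #A^σ·#(A^τ)²`
(`KurodaRelationSymmetricThree.lean`) and the tree's Chevalley calculus (`AmbiguousClassIndexFormula.lean`)
for the two QUADRATIC steps `L/K`, `R/k` reduce it to a comparison of unit indices and of ramified primes;
this file supplies the element identities for the units, its sequel `DihedralUnitCohomologyComparison.lean`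
the three index identities.

## Setting (abstract tower; the sequel files instantiate it on fixed fields)
`σ, τ ∈ Gal(L/k)` with `σ³ = 1`, `τ² = 1`, `τσ = σ²τ`; `R` a `k`-algebra mapping to `L`, Galois over `k`
with group generated by `δ`, realising the fixed field of `σ` (`σ x = x ↔ x ∈ R`) with `τ|_R = δ`; `K` with
`L/K` Galois, group generated by `τK` acting as `τ`.  So `⟨σ, τ⟩ ≅ S₃`, `K = L^τ`, `R = L^σ`, `k = L^{σ,τ}`.
Everything lives in `Lˣ` (tree: `unitsE`, `unitsIncl`, `Herbrand.norm`, `Herbrand.twist`).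

## Results (`N₃ x = x · σx · σ²x`; all from `σ²(τ-fixed) = τ σ(·)` and three-term products)
* `norm_eq_mul_smul` — `N_G y = y · g y` for `G = ⟨g⟩` of order `2`; `mem_unitsE_iff_isIntegral`,
  `unitsIncl_mem_unitsE_iff` — `φ(y) ∈ E_L ↔ y ∈ E_R` (`φ : Rˣ → Lˣ`).
* `eq_norm3_mul_twist_of_cocycle`, `norm3_cocycle` — (U4) a cocycle `u τu = 1` is its `σ`-norm
  `N₃ u` (a `σ`-FIXED cocycle) times the coboundary `τ(σu)/σu`.
* `eq_twist_norm3_of_fixed_cocycle` — (U5) a `σ`-fixed cocycle bounding in `E_L` bounds by the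
  `σ`-fixed `N₃ v · u`.
* `eq_norm3_mul_norm_of_fixed` — (U1) a `τ`-fixed `η` is `N₃ η` (fixed by `σ` AND `τ`) times the norm
  `(ση)⁻¹ τ(ση)⁻¹`: **`E_K = E_k · N_{L/K}(E_L)`**.
* `eq_norm_norm3_of_fixed_norm` — (U2) a `⟨σ,τ⟩`-fixed `ε = x τx` is `y τy` with `y = N₃ x / ε`
  `σ`-fixed: **`E_k ∩ N_{L/K} Lˣ = E_k ∩ N_{R/k} Rˣ`** (and with units, `E_k ∩ N_{L/K} E_L = N_{R/k} E_R`).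
* §4: `τK² = 1`, `δ² = 1`, `N_{L/K} u = u τu`, `N_{R/k} y = y δy`, `Kˣ = {τu = u}`, `kˣ = {δy = y}`.

References: [CaputoNuccio2020] L. Caputo, F. A. E. Nuccio Mortarino Majno di Capriglio, *Class number
formula for dihedral extensions*, Glasgow Math. J. 62 (2020) 323–353 (arXiv:1803.04064), Prop. 2.1,
Lemma 2.4 (`I_G B ⊆ B^Σ + B^{Σ'}`), Lemma 2.9, Prop. 3.12; C. D. Walter, *Brauer's class number relation*,
Acta Arith. 35 (1979) 33–40; [Bartel2012] A. Bartel, J. reine angew. Math. 668 (2012) Cor. 5.2;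
[Lang1990] S. Lang, *Cyclotomic Fields I and II*, Ch. 13 §4 (Chevalley's calculus, tree).
-/

noncomputable section

open scoped NumberField

namespace Literature.NumberTheory.NumberFields.DihedralUnits

open Literature.NumberTheory.GaloisRepresentations Literature.NumberTheory.GaloisRepresentations.Herbrand
  Literature.NumberTheory.GaloisRepresentations.MinkowskiUnit
  Literature.NumberTheory.GaloisRepresentations.CyclicNormIndex

/-! ### §0 The norm of a group of order two -/

section OrderTwo

variable {G M : Type*} [Group G] [CommGroup M] [MulDistribMulAction G M]

/-- If `g ≠ 1`, `g² = 1` generates `G` then `#G = 2`. [cite: Lang1990, Ch. 13 §4 (cyclic group of prime order)] -/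
theorem card_eq_two_of_generator {g : G} (hg : ∀ h : G, h ∈ Subgroup.zpowers g) (hg2 : g ^ 2 = 1)
    (hg1 : g ≠ 1) : Nat.card G = 2 := by
  rw [← orderOf_eq_card_of_forall_mem_zpowers hg]
  exact orderOf_eq_prime hg2 hg1

/-- For `G = {1, g}` of order two, `N_G y = y · g y`. [cite: Lang1990, Ch. 13 §4 Lemma 4.1 (the norm `N = 1 + σ`)] -/
theorem norm_eq_mul_smul [Fintype G] {g : G} (hg : ∀ h : G, h ∈ Subgroup.zpowers g) (hg2 : g ^ 2 = 1)
    (hg1 : g ≠ 1) (y : M) : Herbrand.norm G y = y * g • y := by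
  rw [Herbrand.norm_apply, ← prod_range_card_pow_eq_prod hg (fun h => h • y),
    card_eq_two_of_generator hg hg2 hg1, Finset.prod_range_succ, Finset.prod_range_succ,
    Finset.prod_range_zero, one_mul, pow_zero, pow_one, one_smul]

/-- For `G = {1, g}` of order two, every element is `1` or `g`. [cite: Lang1990, Ch. 13 §4 (cyclic group of prime order)] -/
theorem eq_one_or_eq_of_generator {g : G} (hg : ∀ h : G, h ∈ Subgroup.zpowers g) (hg2 : g ^ 2 = 1)
    (h : G) : h = 1 ∨ h = g := by
  obtain ⟨n, rfl⟩ := Subgroup.mem_zpowers_iff.mp (hg h)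
  rcases Int.even_or_odd n with ⟨m, rfl⟩ | ⟨m, rfl⟩
  · left
    rw [← two_mul, zpow_mul, show (g ^ (2 : ℤ)) = g ^ 2 from zpow_ofNat g 2, hg2, one_zpow]
  · right
    rw [zpow_add, zpow_mul, show (g ^ (2 : ℤ)) = g ^ 2 from zpow_ofNat g 2, hg2, one_zpow, one_mul,
      zpow_one]

end OrderTwo

/-! ### §1 Units: integrality transport along `R → L` -/

section Units

variable {R L : Type} [Field R] [Field L] [Algebra R L]

/-- `a ∈ E_L` iff `a` and `a⁻¹` are integral. [cite: NeukirchANT1999, Ch. I §2 (units of the ring of integers)] -/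
theorem mem_unitsE_iff_isIntegral {a : Lˣ} :
    a ∈ unitsE L ↔ IsIntegral ℤ (a : L) ∧ IsIntegral ℤ ((a⁻¹ : Lˣ) : L) := by
  constructor
  · rintro ⟨x, rfl⟩
    exact ⟨(x : 𝓞 L).isIntegral_coe, by
      rw [← map_inv]; exact ((x⁻¹ : (𝓞 L)ˣ) : 𝓞 L).isIntegral_coe⟩
  · rintro ⟨h1, h2⟩
    let x : 𝓞 L := ⟨(a : L), h1⟩
    let y : 𝓞 L := ⟨((a⁻¹ : Lˣ) : L), h2⟩
    have hxy : x * y = 1 := by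
      apply Subtype.ext
      change (a : L) * ((a⁻¹ : Lˣ) : L) = 1
      rw [← Units.val_mul, mul_inv_cancel, Units.val_one]
    have hyx : y * x = 1 := by rw [mul_comm, hxy]
    exact ⟨⟨x, y, hxy, hyx⟩, Units.ext rfl⟩

/-- Integrality is invariant along the injective map `R → L`: `φ(y) ∈ E_L ↔ y ∈ E_R` for
`φ = Rˣ → Lˣ`. [cite: NeukirchANT1999, Ch. I §2 Prop. (2.4) (integrality is transitive)] -/
theorem unitsIncl_mem_unitsE_iff (y : Rˣ) : unitsIncl R L y ∈ unitsE L ↔ y ∈ unitsE R := by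
  rw [mem_unitsE_iff_isIntegral, mem_unitsE_iff_isIntegral, ← map_inv, coe_unitsIncl, coe_unitsIncl,
    isIntegral_algebraMap_iff (algebraMap R L).injective,
    isIntegral_algebraMap_iff (algebraMap R L).injective]

/-- `(unitsE R).map φ = unitsE L ⊓ φ(Rˣ)`. [cite: NeukirchANT1999, Ch. I §2 Prop. (2.4)] -/
theorem map_unitsIncl_unitsE :
    (unitsE R).map (unitsIncl R L) = unitsE L ⊓ (unitsIncl R L).range := by
  ext u
  simp only [Subgroup.mem_map, Subgroup.mem_inf, MonoidHom.mem_range]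
  constructor
  · rintro ⟨y, hy, rfl⟩
    exact ⟨(unitsIncl_mem_unitsE_iff y).mpr hy, y, rfl⟩
  · rintro ⟨hu, y, rfl⟩
    exact ⟨y, (unitsIncl_mem_unitsE_iff y).mp hu, rfl⟩

end Units

/-! ### §2 The `S₃` tower: element identities -/

section Setting

variable {k R L : Type} [Field k] [Field R] [Field L] [Algebra k R] [Algebra k L] [Algebra R L]
  {K : Type} [Field K] [Algebra K L]
  {σ τ : L ≃ₐ[k] L} {τK : L ≃ₐ[K] L} {δ : R ≃ₐ[k] R}

/-- `τK • u = τ • u` on `Lˣ` when `τK` acts as `τ`. [cite: CaputoNuccio2020, §2 (notation)] -/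
theorem smul_eq_of_apply_eq (hτK : ∀ x : L, τK x = τ x) (u : Lˣ) : τK • u = τ • u :=
  Units.ext (hτK u)

/-- `φ(δ • y) = τ • φ(y)` for `φ = Rˣ → Lˣ` when `τ|_R = δ`. [cite: CaputoNuccio2020, §3 (notation: `F = L^G`, `K = L^Σ`)] -/
theorem unitsIncl_smul (hδ : ∀ y : R, algebraMap R L (δ y) = τ (algebraMap R L y)) (y : Rˣ) :
    unitsIncl R L (δ • y) = τ • unitsIncl R L y :=
  Units.ext (hδ y)

omit [Algebra k R] in
/-- `σ`-fixed elements of `Lˣ` are exactly `φ(Rˣ)` when `R` realises `L^σ`. [cite: CaputoNuccio2020, §3 (`F = L^G`)] -/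
theorem smul_eq_self_iff_mem_range (hR : ∀ x : L, σ x = x ↔ x ∈ Set.range (algebraMap R L))
    (u : Lˣ) : σ • u = u ↔ u ∈ (unitsIncl R L).range := by
  constructor
  · intro h
    have h' : σ (u : L) = u := congrArg Units.val h
    obtain ⟨y, hy⟩ := (hR u).mp h'
    have hy0 : y ≠ 0 := by
      rintro rfl
      rw [map_zero] at hy
      exact u.ne_zero hy.symm
    exact ⟨Units.mk0 y hy0, Units.ext hy⟩
  · rintro ⟨y, rfl⟩
    exact Units.ext ((hR _).mpr ⟨y, rfl⟩)

omit [Algebra k R] in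
/-- `σ` fixes `φ(y)`. [cite: CaputoNuccio2020, §3 (`F = L^G`)] -/
theorem smul_unitsIncl_eq (hR : ∀ x : L, σ x = x ↔ x ∈ Set.range (algebraMap R L)) (y : Rˣ) :
    σ • unitsIncl R L y = unitsIncl R L y :=
  (smul_eq_self_iff_mem_range hR _).mpr ⟨y, rfl⟩

/-- The relation `τ σ = σ² τ` on `Lˣ`: `τ • (σ • u) = σ • (σ • (τ • u))`. [cite: CaputoNuccio2020, §2 (`σρ = ρ⁻¹σ`)] -/
theorem tau_smul_sigma_smul (hτσ : τ * σ = σ ^ 2 * τ) (u : Lˣ) :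
    τ • (σ • u) = σ • (σ • (τ • u)) := by
  rw [smul_smul, hτσ, pow_two, mul_smul, mul_smul]

/-- `σ • (σ • (σ • u)) = u`. [cite: CaputoNuccio2020, §2 (`ρ^q = 1`)] -/
theorem sigma_smul_three (hσ : σ ^ 3 = 1) (u : Lˣ) : σ • (σ • (σ • u)) = u := by
  rw [smul_smul, smul_smul, ← pow_two, ← pow_succ, hσ, one_smul]

/-- `τ • (τ • u) = u`. [cite: CaputoNuccio2020, §2 (`σ² = 1`)] -/
theorem tau_smul_two (hτ : τ ^ 2 = 1) (u : Lˣ) : τ • (τ • u) = u := by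
  rw [smul_smul, ← pow_two, hτ, one_smul]

/-- **`σ²η = τ(ση)` for `τ`-fixed `η`.** [cite: CaputoNuccio2020, §2 (relation `σρ = ρ⁻¹σ`)] -/
theorem smul_sq_eq_tau_smul (hτσ : τ * σ = σ ^ 2 * τ) {η : Lˣ} (hη : τ • η = η) :
    σ • (σ • η) = τ • (σ • η) := by
  rw [tau_smul_sigma_smul hτσ, hη]

/-- The three-term product `u · σu · σ²u` is `σ`-fixed. [cite: CaputoNuccio2020, §2 (`N_G`)] -/
theorem sigma_smul_norm3 (hσ : σ ^ 3 = 1) (u : Lˣ) :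
    σ • (u * σ • u * σ • (σ • u)) = u * σ • u * σ • (σ • u) := by
  rw [smul_mul', smul_mul', sigma_smul_three hσ, mul_comm, ← mul_assoc, mul_comm u]

/-- The relation `τ σ² = σ τ` (from `τσ = σ²τ`, `σ³ = 1`). [cite: CaputoNuccio2020, §2 (`σρ = ρ⁻¹σ`)] -/
theorem tau_mul_sigma_sq (hσ : σ ^ 3 = 1) (hτσ : τ * σ = σ ^ 2 * τ) : τ * σ ^ 2 = σ * τ := by
  have h4 : σ ^ 4 = σ := by
    rw [show (4 : ℕ) = 3 + 1 from rfl, pow_succ, hσ, one_mul]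
  calc τ * σ ^ 2 = τ * σ * σ := by rw [pow_two, mul_assoc]
    _ = σ ^ 2 * τ * σ := by rw [hτσ]
    _ = σ ^ 2 * (σ ^ 2 * τ) := by rw [mul_assoc, hτσ]
    _ = σ ^ 2 * σ ^ 2 * τ := by rw [mul_assoc]
    _ = σ * τ := by rw [← pow_add, h4]

/-- `τ • (σ • (σ • u)) = σ • (τ • u)`. [cite: CaputoNuccio2020, §2 (`σρ = ρ⁻¹σ`)] -/
theorem tau_smul_sigma_smul_sigma_smul (hσ : σ ^ 3 = 1) (hτσ : τ * σ = σ ^ 2 * τ) (u : Lˣ) :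
    τ • (σ • (σ • u)) = σ • (τ • u) := by
  rw [smul_smul σ σ u, ← pow_two, smul_smul, tau_mul_sigma_sq hσ hτσ, mul_smul]

/-- `τ` of the three-term product: `τ(u·σu·σ²u) = τu·σ(τu)·σ²(τu)`. [cite: CaputoNuccio2020, §2 (`N_G` commutes with `Δ` up to inversion)] -/
theorem tau_smul_norm3 (hσ : σ ^ 3 = 1) (hτσ : τ * σ = σ ^ 2 * τ) (u : Lˣ) :
    τ • (u * σ • u * σ • (σ • u)) = τ • u * σ • (τ • u) * σ • (σ • (τ • u)) := by
  rw [smul_mul', smul_mul', tau_smul_sigma_smul hτσ, tau_smul_sigma_smul_sigma_smul hσ hτσ, mul_assoc,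
    mul_comm (σ • (σ • (τ • u))), ← mul_assoc]

end Setting

/-! ### §3 The three-term product `N₃ x = x · σx · σ²x` and the four element identities -/

section Elements

variable {k R L : Type} [Field k] [Field R] [Field L] [Algebra k R] [Algebra k L] [Algebra R L]
  {σ τ : L ≃ₐ[k] L}

/-- `N₃(x y) = N₃ x · N₃ y`. [cite: CaputoNuccio2020, §2 (`N_G`)] -/
theorem norm3_mul (x y : Lˣ) :
    x * y * σ • (x * y) * σ • (σ • (x * y)) = (x * σ • x * σ • (σ • x)) * (y * σ • y * σ • (σ • y)) := by
  rw [smul_mul', smul_mul']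
  simp only [mul_assoc, mul_left_comm]

/-- `N₃ x = x³` for `σ`-fixed `x`. [cite: CaputoNuccio2020, §2 (`N_G` on `B^G`)] -/
theorem norm3_of_fixed {x : Lˣ} (hx : σ • x = x) : x * σ • x * σ • (σ • x) = x * (x * x) := by
  rw [hx, hx, mul_assoc]

/-- (U4) A cocycle `u τu = 1` differs from its `σ`-norm by a coboundary:
`u = N₃ u · (τ w / w)⁻¹ …`, precisely `u = N₃ u · (τ(σu)/σu)`. [cite: CaputoNuccio2020, Lemma 2.9] -/
theorem eq_norm3_mul_twist_of_cocycle (hτσ : τ * σ = σ ^ 2 * τ) {u : Lˣ} (hu : u * τ • u = 1) :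
    u = (u * σ • u * σ • (σ • u)) * (τ • (σ • u) / σ • u) := by
  have hτu : τ • u = u⁻¹ := eq_inv_of_mul_eq_one_right hu
  have h2 : σ • (σ • u) = (τ • (σ • u))⁻¹ := by
    rw [tau_smul_sigma_smul hτσ, hτu, smul_inv', smul_inv', inv_inv]
  rw [h2, Units.ext_iff]
  push_cast
  field_simp

/-- The `σ`-norm of a cocycle is a `σ`-fixed cocycle: `σ(N₃ u) = N₃ u` and `N₃ u · τ(N₃ u) = 1`
if `u τu = 1`. [cite: CaputoNuccio2020, Lemma 2.9] -/
theorem norm3_cocycle (hσ : σ ^ 3 = 1) (hτσ : τ * σ = σ ^ 2 * τ) {u : Lˣ} (hu : u * τ • u = 1) :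
    σ • (u * σ • u * σ • (σ • u)) = u * σ • u * σ • (σ • u) ∧
      (u * σ • u * σ • (σ • u)) * τ • (u * σ • u * σ • (σ • u)) = 1 := by
  refine ⟨sigma_smul_norm3 hσ u, ?_⟩
  rw [tau_smul_norm3 hσ hτσ, ← norm3_mul, hu, smul_one, smul_one, mul_one, mul_one]

/-- (U5) A `σ`-fixed cocycle that bounds in `E_L` bounds by a `σ`-fixed element:
if `σu = u`, `u τu = 1`, `u = τv/v` then `u = τw/w` with `w = N₃ v · u`, `σw = w`.
[cite: CaputoNuccio2020, Lemma 2.9] -/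
theorem eq_twist_norm3_of_fixed_cocycle (hσ : σ ^ 3 = 1) (hτσ : τ * σ = σ ^ 2 * τ) {u v : Lˣ}
    (hσu : σ • u = u) (hu : u * τ • u = 1) (huv : u = τ • v / v) :
    u = τ • (v * σ • v * σ • (σ • v) * u) / (v * σ • v * σ • (σ • v) * u) ∧
      σ • (v * σ • v * σ • (σ • v) * u) = v * σ • v * σ • (σ • v) * u := by
  refine ⟨?_, by rw [smul_mul', sigma_smul_norm3 hσ, hσu]⟩
  have hτu : τ • u = u⁻¹ := eq_inv_of_mul_eq_one_right hu
  have hτv : τ • v = u * v := by rw [huv, div_mul_cancel]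
  rw [smul_mul', tau_smul_norm3 hσ hτσ, hτv, hτu]
  simp only [smul_mul', hσu]
  rw [Units.ext_iff]
  push_cast
  field_simp

/-- (U1) A `τ`-fixed element is its `σ`-norm times a norm: `η = N₃ η · ((ση)⁻¹ · τ (ση)⁻¹)`, where
`N₃ η` is `σ`- and `τ`-fixed. [cite: CaputoNuccio2020, Prop. 2.1] -/
theorem eq_norm3_mul_norm_of_fixed (hσ : σ ^ 3 = 1) (hτσ : τ * σ = σ ^ 2 * τ) {η : Lˣ} (hη : τ • η = η) :
    η = (η * σ • η * σ • (σ • η)) * ((σ • η)⁻¹ * τ • (σ • η)⁻¹) ∧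
      σ • (η * σ • η * σ • (σ • η)) = η * σ • η * σ • (σ • η) ∧
      τ • (η * σ • η * σ • (σ • η)) = η * σ • η * σ • (σ • η) := by
  refine ⟨?_, sigma_smul_norm3 hσ η, ?_⟩
  · rw [smul_sq_eq_tau_smul hτσ hη, smul_inv', Units.ext_iff]
    push_cast
    field_simp
  · rw [tau_smul_norm3 hσ hτσ, hη]

/-- (U2) A `⟨σ,τ⟩`-fixed element that is a norm `x τx` is the norm of a `σ`-fixed element:
`ε = y τy` with `y = N₃ x / ε`, `σy = y`. [cite: CaputoNuccio2020, Prop. 2.1] -/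
theorem eq_norm_norm3_of_fixed_norm (hσ : σ ^ 3 = 1) (hτσ : τ * σ = σ ^ 2 * τ) {ε x : Lˣ}
    (hσε : σ • ε = ε) (hτε : τ • ε = ε) (hεx : ε = x * τ • x) :
    ε = (x * σ • x * σ • (σ • x) / ε) * τ • (x * σ • x * σ • (σ • x) / ε) ∧
      σ • (x * σ • x * σ • (σ • x) / ε) = x * σ • x * σ • (σ • x) / ε := by
  refine ⟨?_, by rw [smul_div', sigma_smul_norm3 hσ, hσε]⟩
  have h3 : ε * (ε * ε) = (x * σ • x * σ • (σ • x)) * τ • (x * σ • x * σ • (σ • x)) := by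
    rw [← norm3_of_fixed hσε, tau_smul_norm3 hσ hτσ, ← norm3_mul, ← hεx]
  rw [smul_div', hτε, div_mul_div_comm, ← h3, Units.ext_iff]
  push_cast
  field_simp

end Elements

/-! ### §4 Galois bookkeeping for the two quadratic steps -/

section GaloisK

variable {k L K : Type} [Field k] [Field L] [Algebra k L] [Field K] [Algebra K L]
  {τ : L ≃ₐ[k] L} {τK : L ≃ₐ[K] L}

/-- `τK² = 1` when `τK` acts as the involution `τ`. [cite: CaputoNuccio2020, §3 (`Σ = Gal(L/K)`)] -/
theorem tauK_sq (hτ : τ ^ 2 = 1) (hτK : ∀ x : L, τK x = τ x) : τK ^ 2 = 1 := by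
  ext x
  have h : (τ ^ 2) x = x := by rw [hτ, AlgEquiv.one_apply]
  rw [pow_two, AlgEquiv.mul_apply] at h
  rw [pow_two, AlgEquiv.mul_apply, hτK, hτK, h, AlgEquiv.one_apply]

/-- `τK ≠ 1` when `τK` acts as `τ ≠ 1`. [cite: CaputoNuccio2020, §3 (`Σ = Gal(L/K)`)] -/
theorem tauK_ne_one (hτ1 : τ ≠ 1) (hτK : ∀ x : L, τK x = τ x) : τK ≠ 1 := by
  intro h
  apply hτ1
  ext x
  rw [← hτK, h, AlgEquiv.one_apply, AlgEquiv.one_apply]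

variable [NumberField K] [NumberField L]

/-- `N_{L/K} u = u · τu`. [cite: Lang1990, Ch. 13 §4 Lemma 4.1 (`N_{K/F}`)] -/
theorem norm_K_eq (hτ : τ ^ 2 = 1) (hτ1 : τ ≠ 1) (hτK : ∀ x : L, τK x = τ x)
    (hgenK : ∀ g : L ≃ₐ[K] L, g ∈ Subgroup.zpowers τK) (u : Lˣ) :
    Herbrand.norm (L ≃ₐ[K] L) u = u * τ • u := by
  rw [norm_eq_mul_smul hgenK (tauK_sq hτ hτK) (tauK_ne_one hτ1 hτK), smul_eq_of_apply_eq hτK]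

/-- `Kˣ ⊆ Lˣ` is `{u : τu = u}`. [cite: Lang1990, Ch. 13 §4 (Galois descent `L^G = K`)] -/
theorem mem_range_unitsIncl_K_iff [IsGalois K L] (hτK : ∀ x : L, τK x = τ x)
    (hgenK : ∀ g : L ≃ₐ[K] L, g ∈ Subgroup.zpowers τK) (u : Lˣ) :
    u ∈ (unitsIncl K L).range ↔ τ • u = u := by
  rw [← mem_ker_twistEnd_iff hgenK, MonoidHom.mem_ker, twistEnd_apply, smul_eq_of_apply_eq hτK,
    div_eq_one]

end GaloisK

section GaloisR

variable {k R L : Type} [Field k] [Field R] [Field L] [Algebra k R] [Algebra k L] [Algebra R L]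
  {σ τ : L ≃ₐ[k] L} {δ : R ≃ₐ[k] R}

/-- `δ² = 1` when `τ|_R = δ` and `τ² = 1`. [cite: CaputoNuccio2020, §3 (`Δ = Gal(F/k)`)] -/
theorem delta_sq (hτ : τ ^ 2 = 1) (hδ : ∀ y : R, algebraMap R L (δ y) = τ (algebraMap R L y)) :
    δ ^ 2 = 1 := by
  ext y
  apply (algebraMap R L).injective
  have h : (τ ^ 2) (algebraMap R L y) = algebraMap R L y := by rw [hτ, AlgEquiv.one_apply]
  rw [pow_two, AlgEquiv.mul_apply] at h
  rw [pow_two, AlgEquiv.mul_apply, hδ, hδ, h, AlgEquiv.one_apply]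

/-- `φ(y · δy) = φy · τ φy`. [cite: CaputoNuccio2020, §3 (`Δ = Gal(F/k)`)] -/
theorem unitsIncl_mul_smul (hδ : ∀ y : R, algebraMap R L (δ y) = τ (algebraMap R L y)) (y : Rˣ) :
    unitsIncl R L (y * δ • y) = unitsIncl R L y * τ • unitsIncl R L y := by
  rw [map_mul, unitsIncl_smul hδ]

/-- `φ(δy / y) = τ φy / φy`. [cite: CaputoNuccio2020, §3 (`Δ = Gal(F/k)`)] -/
theorem unitsIncl_twist (hδ : ∀ y : R, algebraMap R L (δ y) = τ (algebraMap R L y)) (y : Rˣ) :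
    unitsIncl R L (twist δ y) = τ • unitsIncl R L y / unitsIncl R L y := by
  rw [twist_apply, map_div, unitsIncl_smul hδ]

omit [Algebra k R] in
/-- A `σ`-fixed unit of `L` is `φ` of a unit of `R`. [cite: CaputoNuccio2020, §3 (`E_F = E_L^G`)] -/
theorem exists_unitsE_R_of_fixed (hR : ∀ x : L, σ x = x ↔ x ∈ Set.range (algebraMap R L)) {u : Lˣ}
    (hu : u ∈ unitsE L) (hσu : σ • u = u) : ∃ y ∈ unitsE R, unitsIncl R L y = u := by
  obtain ⟨y, rfl⟩ := (smul_eq_self_iff_mem_range hR u).mp hσu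
  exact ⟨y, (unitsIncl_mem_unitsE_iff y).mp hu, rfl⟩

variable [NumberField k] [NumberField R]

/-- `N_{R/k} y = y · δy`. [cite: Lang1990, Ch. 13 §4 Lemma 4.1 (`N_{K/F}`)] -/
theorem norm_k_eq (hτ : τ ^ 2 = 1) (hδ : ∀ y : R, algebraMap R L (δ y) = τ (algebraMap R L y))
    (hgenk : ∀ g : R ≃ₐ[k] R, g ∈ Subgroup.zpowers δ) (hδ1 : δ ≠ 1) (y : Rˣ) :
    Herbrand.norm (R ≃ₐ[k] R) y = y * δ • y :=
  norm_eq_mul_smul hgenk (delta_sq hτ hδ) hδ1 y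

omit [Field L] [Algebra k L] [Algebra R L] in
/-- `kˣ ⊆ Rˣ` is `{y : δy = y}`. [cite: Lang1990, Ch. 13 §4 (Galois descent `L^G = K`)] -/
theorem mem_range_unitsIncl_k_iff [IsGalois k R] (hgenk : ∀ g : R ≃ₐ[k] R, g ∈ Subgroup.zpowers δ)
    (y : Rˣ) : y ∈ (unitsIncl k R).range ↔ δ • y = y := by
  rw [← mem_ker_twistEnd_iff hgenk, MonoidHom.mem_ker, twistEnd_apply, div_eq_one]

end GaloisR

end Literature.NumberTheory.NumberFields.DihedralUnits
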